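import Summits.HodgeConjecture.CorCM.MultiFieldWeilUnitGramFour
import Summits.HodgeConjecture.CorCM.MultiFieldWeilUnitsMenuGrouped
import HarnessLib

/-!
# MULTI-FIELD WEIL ENGINE — UNITS BY SHAPE: three classes over an octic field (uniform adjugate treatment), and the reading of the shapes on the `τ`-embeddings of one CM
# field (decic triples and quadruples, octic triples) — the independence hypothesis of the grouped menu discharged from combinatorial shape conditions

Cell `pub-hodgecm2` (COR-CM), seat b30 gen 40 (2026-08-26); count-neutral own lane MULTI-FIELD WEIL ENGINE (stem `MultiFieldWeil*`), sequel of `CorCM/MultiFieldWeilUnitGramFour.lean`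
(G1: four `2`-sets on five letters, the rank bound, transport) and `CorCM/MultiFieldWeilUnitsMenuGrouped.lean` (U7: the grouped headline with the independence hypothesis `hli`).
Theorems only; no definition, no named fact, no `sorry`.  HONEST FRAMING: §1 is pure finite combinatorics, §2–§3 read CM types on embeddings; `HC_CM` is NOT touched.

* §1 (census, four letters) `det_mul_eq_zero_of_gram_three` — the adjugate identity for a symmetric `3 × 3` system; `gram_det_three_four` — the determinant of the Gram matrix
  (divided by `4`) of three sets of sizes `cᵢ ∈ {1, 2}` on four letters at all `64` size ∕ intersection patterns: it vanishes only when two singletons coincide (R1), two `2`-sets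
  are complementary (R2), or two singletons and a `2`-set containing BOTH OR NEITHER of them (R3); `eq_of_card_inter_eq_card`; **`linearIndependent_cells_of_three_four`** —
  THREE SETS OF SIZES `1` OR `2` ON FOUR LETTERS, pairwise neither equal nor complementary, such that a `2`-set SEPARATES any two singletons among them (contains exactly one),
  have independent centred indicators (card form `…_of_card_eq_three`).  This is every independent triple of the octic menu in ONE statement (U2 §2 three singletons, U5a
  three pairs ∕ two pairs and a singleton, and the new case two singletons and a separating pair); the excluded triple `{q}, {q'}, {q,q'}^{±}` is dependent (U5a docstring).
* §2 (reading) `cmType_val_eq_of_forall_comp`, `cmType_val_eq_compl_of_forall_comp` — a CM type of `K ⊇ i(k)` is determined by its members over `τ` (and so is its complement);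
  `card_univ_filter_subtype_mem`, `card_subtype_comp_eq` — counting on the subtype of `τ`-embeddings.
* §3 (one field, the `hli` hypothesis of U7 discharged) **`linearIndependent_typeCells_of_three_pairs`** (decic field, three types of `k`-signature `(2,3)`, pairwise distinct:
  free), **`linearIndependent_typeCells_of_four_pairs`** (decic field, four pairwise distinct `(2,3)`-types with (H1) every type meets another over `τ` and (H2) some
  `τ`-embedding in `1`, `3` or `4` of them), **`linearIndependent_typeCells_of_three_octic`** (octic field, three types with `1` or `2` members over `τ`, pairwise neither equal
  nor conjugate, a `(2,2)`-type separating any two `(1,3)`-types).  Proof: transport to `Fin n` along `Fintype.equivFinOfCardEq` (G1 `linearIndependent_cells_map_equiv_iff`)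
  and §1 ∕ G1 ∕ U5a.
* §4 (gen 40, v2) **`fintype_card_lt_of_linearIndependent_typeCells`** — THE RANK BOUND READ ON THE TYPES: U7's hypothesis `hli j` forces `c j < nJ j` (three sextic ∕ four
  octic ∕ five decic classes are beyond the units method; G1's rank bound transported).
USE: `CorCM/MultiFieldWeilUnitsMenuShapes.lean` — the grouped menu with shapes instead of `hli`.
[cite: Lang2002, XIII §4; XV §1] [cite: Shimura1998, §18.2 Lemma (i)] [cite: Deligne1982HodgeCycles, §5 (b)]

## References
* [Lang2002] S. Lang, *Algebra*, GTM 211, XIII §4 (linear independence, rank), XV §1 (bilinear forms, Gram matrices).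
* [Shimura1998] G. Shimura, *Abelian varieties with complex multiplication and modular functions*, §18.2 Lemma (i) (CM types and their restrictions).
* [Deligne1982HodgeCycles] P. Deligne, *Hodge cycles on abelian varieties*, LNM 900, §5 (b) (a CM type contains one of each conjugate pair).
-/

noncomputable section

open NumberField

namespace Summit.HodgeConjecture.CorCM.MultiFieldWeil

open Finset

open scoped Classical

/-! ## §1 Three sets of sizes `1` or `2` on four letters -/

section Three

variable {k : ℕ}

/-- **THE ADJUGATE IDENTITY** for a symmetric `3 × 3` system with diagonal `dᵢ` and off-diagonal `xᵢⱼ`: `det · gᵢ` is a polynomial combination of the three equations.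
[cite: Lang2002, XIII §4; XV §1] -/
theorem det_mul_eq_zero_of_gram_three (g₁ g₂ g₃ d₁ d₂ d₃ x₁₂ x₁₃ x₂₃ : ℚ) (E₁ : d₁ * g₁ + x₁₂ * g₂ + x₁₃ * g₃ = 0) (E₂ : x₁₂ * g₁ + d₂ * g₂ + x₂₃ * g₃ = 0)
    (E₃ : x₁₃ * g₁ + x₂₃ * g₂ + d₃ * g₃ = 0) :
    (2 * x₁₂ * x₁₃ * x₂₃ - d₃ * x₁₂ ^ 2 - d₂ * x₁₃ ^ 2 - d₁ * x₂₃ ^ 2 + d₁ * d₂ * d₃) * g₁ = 0 ∧ (2 * x₁₂ * x₁₃ * x₂₃ - d₃ * x₁₂ ^ 2 - d₂ * x₁₃ ^ 2 - d₁ * x₂₃ ^ 2 + d₁ * d₂ * d₃) * g₂ = 0 ∧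
      (2 * x₁₂ * x₁₃ * x₂₃ - d₃ * x₁₂ ^ 2 - d₂ * x₁₃ ^ 2 - d₁ * x₂₃ ^ 2 + d₁ * d₂ * d₃) * g₃ = 0 := by
  refine ⟨?_, ?_, ?_⟩
  · linear_combination (-x₂₃ ^ 2 + d₂ * d₃) * E₁ + (x₁₃ * x₂₃ - d₃ * x₁₂) * E₂ + (x₁₂ * x₂₃ - d₂ * x₁₃) * E₃
  · linear_combination (x₁₃ * x₂₃ - d₃ * x₁₂) * E₁ + (-x₁₃ ^ 2 + d₁ * d₃) * E₂ + (x₁₂ * x₁₃ - d₁ * x₂₃) * E₃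
  · linear_combination (x₁₂ * x₂₃ - d₂ * x₁₃) * E₁ + (x₁₂ * x₁₃ - d₁ * x₂₃) * E₂ + (-x₁₂ ^ 2 + d₁ * d₂) * E₃

/-- **THE DETERMINANT OF THREE SETS OF SIZES `cᵢ ∈ {1,2}` ON FOUR LETTERS** (Gram matrix divided by `4`: diagonal `cᵢ(4 − cᵢ)`, off-diagonal `4aᵢⱼ − cᵢcⱼ`, `aᵢⱼ = |Qᵢ ∩ Qⱼ| ≤ 1`)
at all `64` patterns: it vanishes only if (R1) two singletons meet, (R2) two `2`-sets are disjoint, or (R3) two singletons meet a `2`-set equally often. [cite: Lang2002, XV §1] -/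
theorem gram_det_three_four (c₁ c₂ c₃ a₁₂ a₁₃ a₂₃ : ℕ) (hc₁ : c₁ = 1 ∨ c₁ = 2) (hc₂ : c₂ = 1 ∨ c₂ = 2) (hc₃ : c₃ = 1 ∨ c₃ = 2) (h₁₂ : a₁₂ ≤ 1) (h₁₃ : a₁₃ ≤ 1)
    (h₂₃ : a₂₃ ≤ 1) :
    (2 * (4 * (a₁₂ : ℚ) - c₁ * c₂) * (4 * (a₁₃ : ℚ) - c₁ * c₃) * (4 * (a₂₃ : ℚ) - c₂ * c₃) - ((c₃ : ℚ) * (4 - c₃)) * (4 * (a₁₂ : ℚ) - c₁ * c₂) ^ 2 - ((c₂ : ℚ) * (4 - c₂)) * (4 * (a₁₃ : ℚ) - c₁ * c₃) ^ 2 - ((c₁ : ℚ) * (4 - c₁)) * (4 * (a₂₃ : ℚ) - c₂ * c₃) ^ 2 + ((c₁ : ℚ) * (4 - c₁)) * ((c₂ : ℚ) * (4 - c₂)) * ((c₃ : ℚ) * (4 - c₃))) ≠ 0 ∨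
      ((c₁ = 1 ∧ c₂ = 1 ∧ a₁₂ = 1) ∨ (c₁ = 1 ∧ c₃ = 1 ∧ a₁₃ = 1) ∨ (c₂ = 1 ∧ c₃ = 1 ∧ a₂₃ = 1)) ∨
      ((c₁ = 2 ∧ c₂ = 2 ∧ a₁₂ = 0) ∨ (c₁ = 2 ∧ c₃ = 2 ∧ a₁₃ = 0) ∨ (c₂ = 2 ∧ c₃ = 2 ∧ a₂₃ = 0)) ∨
      ((c₁ = 1 ∧ c₂ = 1 ∧ c₃ = 2 ∧ a₁₃ = a₂₃) ∨ (c₁ = 1 ∧ c₃ = 1 ∧ c₂ = 2 ∧ a₁₂ = a₂₃) ∨ (c₂ = 1 ∧ c₃ = 1 ∧ c₁ = 2 ∧ a₁₂ = a₁₃)) := by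
  rcases hc₁ with rfl | rfl <;> rcases hc₂ with rfl | rfl <;> rcases hc₃ with rfl | rfl <;> rcases Nat.le_one_iff_eq_zero_or_eq_one.1 h₁₂ with rfl | rfl <;>
    rcases Nat.le_one_iff_eq_zero_or_eq_one.1 h₁₃ with rfl | rfl <;> rcases Nat.le_one_iff_eq_zero_or_eq_one.1 h₂₃ with rfl | rfl
  all_goals norm_num

/-- Two finite sets of the same size meeting in a set of that size are equal. [folklore] -/
theorem eq_of_card_inter_eq_card {α : Type} [DecidableEq α] {Q T : Finset α} (h1 : (Q ∩ T).card = Q.card) (h2 : Q.card = T.card) : Q = T := by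
  have hQ : Q ∩ T = Q := Finset.eq_of_subset_of_card_le Finset.inter_subset_left h1.ge
  have hsub : Q ⊆ T := by rw [← hQ]; exact Finset.inter_subset_right
  exact Finset.eq_of_subset_of_card_le hsub h2.ge

/-- **THREE SETS OF SIZES `1` OR `2` ON FOUR LETTERS, PAIRWISE NEITHER EQUAL NOR COMPLEMENTARY, EVERY `2`-SET SEPARATING EVERY TWO SINGLETONS, HAVE INDEPENDENT CENTRED
INDICATORS** (enumerated form) — all the independent triples of the octic menu at once. [cite: Lang2002, XV §1] -/
theorem linearIndependent_cells_of_three_four (hk : k = 4) {ι : Type} [Fintype ι] (i₁ i₂ i₃ : ι) (h₁₂ : i₁ ≠ i₂) (h₁₃ : i₁ ≠ i₃) (h₂₃ : i₂ ≠ i₃)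
    (huniv : ∀ i, i = i₁ ∨ i = i₂ ∨ i = i₃) (Q : ι → Finset (Fin k)) (hc : ∀ i, (Q i).card = 1 ∨ (Q i).card = 2) (hQ : ∀ i j, i ≠ j → Q j ≠ Q i)
    (hQc : ∀ i j, i ≠ j → Q j ≠ (Q i)ᶜ)
    (hsep : ∀ i j l, i ≠ j → (Q i).card = 1 → (Q j).card = 1 → (Q l).card = 2 → (Q i ∩ Q l).card ≠ (Q j ∩ Q l).card) :
    LinearIndependent ℚ fun i : ι => fun y : Fin k => ((k : ℚ) * (if y ∈ Q i then 1 else 0) - (Q i).card) := by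
  -- intersections have at most one letter
  have hle : ∀ i j, i ≠ j → (Q i ∩ Q j).card ≤ 1 := fun i j hij => by
    rcases hc i with h1 | h2
    · exact (Finset.card_le_card Finset.inter_subset_left).trans h1.le
    · rcases hc j with h1' | h2'
      · exact (Finset.card_le_card Finset.inter_subset_right).trans h1'.le
      · exact card_inter_le_one_of_ne h2 h2' (hQ i j hij)
  -- the exceptional patterns contradict the hypotheses
  have hR1 : ∀ i j, i ≠ j → ¬ ((Q i).card = 1 ∧ (Q j).card = 1 ∧ (Q i ∩ Q j).card = 1) := fun i j hij ⟨hi, hj, ha⟩ =>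
    hQ i j hij (eq_of_card_inter_eq_card (ha.trans hi.symm) (hi.trans hj.symm)).symm
  have hR2 : ∀ i j, i ≠ j → ¬ ((Q i).card = 2 ∧ (Q j).card = 2 ∧ (Q i ∩ Q j).card = 0) := fun i j hij ⟨hi, hj, ha⟩ => by
    have h1 := card_inter_eq_one_of_four hk hi hj (hQ i j hij) (hQc i j hij)
    omega
  have hR3 : ∀ i j l, i ≠ j → ¬ ((Q i).card = 1 ∧ (Q j).card = 1 ∧ (Q l).card = 2 ∧ (Q i ∩ Q l).card = (Q j ∩ Q l).card) := fun i j l hij ⟨hi, hj, hl, ha⟩ =>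
    hsep i j l hij hi hj hl ha
  subst hk
  rw [Fintype.linearIndependent_iff]
  intro g hg
  have E₁ := gram_eq_zero_of_sum_smul_eq_zero Q hg i₁
  have E₂ := gram_eq_zero_of_sum_smul_eq_zero Q hg i₂
  have E₃ := gram_eq_zero_of_sum_smul_eq_zero Q hg i₃
  rw [sum_eq_three i₁ i₂ i₃ h₁₂ h₁₃ h₂₃ huniv] at E₁ E₂ E₃
  rw [Finset.inter_comm (Q i₂) (Q i₁), Finset.inter_comm (Q i₃) (Q i₁)] at E₁
  rw [Finset.inter_comm (Q i₃) (Q i₂)] at E₂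
  simp only [Finset.inter_self] at E₁ E₂ E₃
  push_cast at E₁ E₂ E₃
  obtain ⟨D₁, D₂, D₃⟩ := det_mul_eq_zero_of_gram_three (g i₁) (g i₂) (g i₃) (((Q i₁).card : ℚ) * (4 - (Q i₁).card)) (((Q i₂).card : ℚ) * (4 - (Q i₂).card))
    (((Q i₃).card : ℚ) * (4 - (Q i₃).card)) (4 * ((Q i₁ ∩ Q i₂).card : ℚ) - (Q i₁).card * (Q i₂).card) (4 * ((Q i₁ ∩ Q i₃).card : ℚ) - (Q i₁).card * (Q i₃).card)
    (4 * ((Q i₂ ∩ Q i₃).card : ℚ) - (Q i₂).card * (Q i₃).card) (by linear_combination (1 / 4 : ℚ) * E₁) (by linear_combination (1 / 4 : ℚ) * E₂)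
    (by linear_combination (1 / 4 : ℚ) * E₃)
  have hboth : g i₁ = 0 ∧ g i₂ = 0 ∧ g i₃ = 0 := by
    rcases gram_det_three_four _ _ _ _ _ _ (hc i₁) (hc i₂) (hc i₃) (hle i₁ i₂ h₁₂) (hle i₁ i₃ h₁₃) (hle i₂ i₃ h₂₃) with hD | (h | h | h) | (h | h | h) | (h | h | h)
    · exact ⟨(mul_eq_zero.1 D₁).resolve_left hD, (mul_eq_zero.1 D₂).resolve_left hD, (mul_eq_zero.1 D₃).resolve_left hD⟩
    · exact absurd h (hR1 i₁ i₂ h₁₂)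
    · exact absurd h (hR1 i₁ i₃ h₁₃)
    · exact absurd h (hR1 i₂ i₃ h₂₃)
    · exact absurd h (hR2 i₁ i₂ h₁₂)
    · exact absurd h (hR2 i₁ i₃ h₁₃)
    · exact absurd h (hR2 i₂ i₃ h₂₃)
    · exact absurd ⟨h.1, h.2.1, h.2.2.1, h.2.2.2⟩ (hR3 i₁ i₂ i₃ h₁₂)
    · exact absurd ⟨h.1, h.2.1, h.2.2.1, by rw [Finset.inter_comm (Q i₃) (Q i₂)]; exact h.2.2.2⟩ (hR3 i₁ i₃ i₂ h₁₃)
    · exact absurd ⟨h.1, h.2.1, h.2.2.1, by rw [Finset.inter_comm (Q i₂) (Q i₁), Finset.inter_comm (Q i₃) (Q i₁)]; exact h.2.2.2⟩ (hR3 i₂ i₃ i₁ h₂₃)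
  intro i
  rcases huniv i with rfl | rfl | rfl
  exacts [hboth.1, hboth.2.1, hboth.2.2]

/-- **THREE SETS OF SIZES `1` OR `2` ON FOUR LETTERS BY SHAPE HAVE INDEPENDENT CENTRED INDICATORS** (cardinality form). [cite: Lang2002, XV §1] -/
theorem linearIndependent_cells_of_three_four_of_card_eq_three (hk : k = 4) {ι : Type} [Fintype ι] (hι : Fintype.card ι = 3) (Q : ι → Finset (Fin k))
    (hc : ∀ i, (Q i).card = 1 ∨ (Q i).card = 2) (hQ : ∀ i j, i ≠ j → Q j ≠ Q i) (hQc : ∀ i j, i ≠ j → Q j ≠ (Q i)ᶜ)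
    (hsep : ∀ i j l, i ≠ j → (Q i).card = 1 → (Q j).card = 1 → (Q l).card = 2 → (Q i ∩ Q l).card ≠ (Q j ∩ Q l).card) :
    LinearIndependent ℚ fun i : ι => fun y : Fin k => ((k : ℚ) * (if y ∈ Q i then 1 else 0) - (Q i).card) := by
  obtain ⟨i₁, i₂, i₃, h₁₂, h₁₃, h₂₃, huniv⟩ := exists_enum_of_card_eq_three hι
  exact linearIndependent_cells_of_three_four hk i₁ i₂ i₃ h₁₂ h₁₃ h₂₃ huniv Q hc hQ hQc hsep

end Three

/-! ## §2 Reading CM types on the `τ`-embeddings -/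

section Reading

variable {K : Type} [Field K] [NumberField K] {k : Type} [Field k] [NumberField k] [IsCMField k]

open Literature.AlgebraicGeometry.Motives (CMType)

/-- **TRANSPORT OF THE CENTRED INDICATORS ALONG A BIJECTION OF THE LETTERS**, instance-polymorphic form of G1's `linearIndependent_cells_map_equiv_iff` (any decidability
instances on the two letter types). [cite: Lang2002, XIII §4] -/
theorem linearIndependent_cells_map_equiv_iff' {α β ι : Type} [Fintype α] [Fintype β] [DecidableEq α] [DecidableEq β] (e : α ≃ β) (Q : ι → Finset α) (n : ℚ)
    (c : ι → ℚ) :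
    (LinearIndependent ℚ fun i => fun b : β => n * (if b ∈ (Q i).map e.toEmbedding then 1 else 0) - c i) ↔
      LinearIndependent ℚ fun i => fun a : α => n * (if a ∈ Q i then 1 else 0) - c i := by
  let F : (β → ℚ) ≃ₗ[ℚ] (α → ℚ) := LinearEquiv.funCongrLeft ℚ ℚ e
  have hF : (F : (β → ℚ) →ₗ[ℚ] (α → ℚ)) ∘ (fun i => fun b : β => n * (if b ∈ (Q i).map e.toEmbedding then 1 else 0) - c i) =
      fun i => fun a : α => n * (if a ∈ Q i then 1 else 0) - c i := by
    funext i a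
    simp only [Function.comp_apply, LinearEquiv.coe_coe, F, LinearEquiv.funCongrLeft_apply, LinearMap.funLeft_apply, Finset.mem_map_equiv,
      Equiv.symm_apply_apply]
  rw [← hF]
  exact ((F : (β → ℚ) →ₗ[ℚ] (α → ℚ)).linearIndependent_iff_of_injOn F.injective.injOn).symm

omit [NumberField K] in
/-- Over an imaginary quadratic `k`, an embedding of `K ⊇ i(k)` not over `τ` has its conjugate over `τ`. [folklore] -/
theorem conjugate_comp_eq_of_comp_ne (h2 : Module.finrank ℚ k = 2) (i : k →+* K) (τ : k →+* ℂ) {s : K →+* ℂ} (hs : s.comp i ≠ τ) :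
    (ComplexEmbedding.conjugate s).comp i = τ := by
  rw [ComplexEmbedding.conjugate_comp]
  rcases QuarticCM.eq_or_eq_conjugate_of_quadratic h2 τ (s.comp i) with h | h
  · exact absurd h hs
  · rw [h]; exact ComplexEmbedding.involutive_conjugate k τ

omit [NumberField K] in
/-- **A CM type is determined by its members over `τ`.** [cite: Deligne1982HodgeCycles, §5 (b)] [cite: Shimura1998, §18.2 Lemma (i)] -/
theorem cmType_val_eq_of_forall_comp (h2 : Module.finrank ℚ k = 2) (i : k →+* K) (τ : k →+* ℂ) (Φ Φ' : CMType K)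
    (h : ∀ s : K →+* ℂ, s.comp i = τ → (s ∈ Φ.1 ↔ s ∈ Φ'.1)) : Φ.1 = Φ'.1 := by
  ext s
  by_cases hs : s.comp i = τ
  · exact h s hs
  · rw [Φ.2 s, Φ'.2 s, not_iff_not]
    exact h _ (conjugate_comp_eq_of_comp_ne h2 i τ hs)

omit [NumberField K] in
/-- **A CM type whose members over `τ` are the non-members of another is its complement (its complex conjugate).** [cite: Deligne1982HodgeCycles, §5 (b)] -/
theorem cmType_val_eq_compl_of_forall_comp (h2 : Module.finrank ℚ k = 2) (i : k →+* K) (τ : k →+* ℂ) (Φ Φ' : CMType K)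
    (h : ∀ s : K →+* ℂ, s.comp i = τ → (s ∈ Φ'.1 ↔ s ∉ Φ.1)) : Φ'.1 = Φ.1ᶜ := by
  ext s
  rw [Set.mem_compl_iff]
  by_cases hs : s.comp i = τ
  · exact h s hs
  · rw [Φ'.2 s, Φ.2 s, h _ (conjugate_comp_eq_of_comp_ne h2 i τ hs), not_not]

omit [NumberField k] [IsCMField k] in
/-- Counting the members of a set of embeddings over `τ` on the subtype of `τ`-embeddings. [folklore] -/
theorem card_univ_filter_subtype_mem (i : k →+* K) (τ : k →+* ℂ) (S : Set (K →+* ℂ)) :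
    ((Finset.univ : Finset {s : K →+* ℂ // s.comp i = τ}).filter fun s => s.1 ∈ S).card = (Finset.univ.filter fun u : K →+* ℂ => u.comp i = τ ∧ u ∈ S).card := by
  rw [← Fintype.card_subtype, ← Fintype.card_subtype]
  exact Fintype.card_congr (Equiv.subtypeSubtypeEquivSubtypeInter (fun u : K →+* ℂ => u.comp i = τ) fun u => u ∈ S)

omit [IsCMField k] in
/-- A field of degree `2n` over the rationals has `n` embeddings over each embedding `τ` of a quadratic subfield. [folklore] -/
theorem card_subtype_comp_eq (i : k →+* K) {n : ℕ} (hdeg : Module.finrank ℚ K = 2 * n) (h2 : Module.finrank ℚ k = 2) (τ : k →+* ℂ) :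
    Fintype.card {s : K →+* ℂ // s.comp i = τ} = n := by
  rw [Fintype.card_subtype]; exact SexticOcticWeil.card_filter_comp_eq_of_finrank (n := n) i hdeg h2 τ

end Reading

/-! ## §3 The independence hypothesis of the grouped menu from shapes, over one field -/

section OneField

variable {K : Type} [Field K] [NumberField K] {k : Type} [Field k] [NumberField k] [IsCMField k]

open Literature.AlgebraicGeometry.Motives (CMType)

omit [IsCMField k] in
/-- The centred type indicators over one field, read on the subtype of `τ`-embeddings and transported to `Fin n`: the general reduction. [cite: Lang2002, XIII §4] -/
theorem linearIndependent_typeCells_of_cells (h2 : Module.finrank ℚ k = 2) (i : k →+* K) {n : ℕ} (hdeg : Module.finrank ℚ K = 2 * n) (τ : k →+* ℂ) {ι : Type}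
    (Ψ : ι → CMType K)
    (h : ∀ (e : {s : K →+* ℂ // s.comp i = τ} ≃ Fin n),
      LinearIndependent ℚ fun t : ι => fun y : Fin n => ((n : ℚ) * (if y ∈ ((Finset.univ : Finset {s : K →+* ℂ // s.comp i = τ}).filter fun s => s.1 ∈ (Ψ t).1).map e.toEmbedding
        then 1 else 0) - ((((Finset.univ : Finset {s : K →+* ℂ // s.comp i = τ}).filter fun s => s.1 ∈ (Ψ t).1).map e.toEmbedding).card : ℚ))) :
    LinearIndependent ℚ fun t : ι => fun s : {s : K →+* ℂ // s.comp i = τ} =>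
      ((n : ℚ) * (if s.1 ∈ (Ψ t).1 then 1 else 0) - ((Finset.univ.filter fun u : K →+* ℂ => u.comp i = τ ∧ u ∈ (Ψ t).1).card : ℚ)) := by
  let e : {s : K →+* ℂ // s.comp i = τ} ≃ Fin n := Fintype.equivFinOfCardEq (card_subtype_comp_eq i hdeg h2 τ)
  have h1 := h e
  rw [linearIndependent_cells_map_equiv_iff'] at h1
  have hfun : (fun t : ι => fun s : {s : K →+* ℂ // s.comp i = τ} =>
      ((n : ℚ) * (if s.1 ∈ (Ψ t).1 then 1 else 0) - ((Finset.univ.filter fun u : K →+* ℂ => u.comp i = τ ∧ u ∈ (Ψ t).1).card : ℚ))) =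
      fun t : ι => fun s : {s : K →+* ℂ // s.comp i = τ} => ((n : ℚ) * (if s ∈ (Finset.univ : Finset {s : K →+* ℂ // s.comp i = τ}).filter fun s => s.1 ∈ (Ψ t).1
        then 1 else 0) - ((((Finset.univ : Finset {s : K →+* ℂ // s.comp i = τ}).filter fun s => s.1 ∈ (Ψ t).1).map e.toEmbedding).card : ℚ)) := by
    funext t s
    rw [Finset.card_map, card_univ_filter_subtype_mem]
    simp only [Finset.mem_filter, Finset.mem_univ, true_and]
  rw [hfun]
  exact h1

/-- **THREE PAIRWISE DISTINCT `(2,3)`-TYPES OVER A DECIC FIELD HAVE INDEPENDENT CENTRED INDICATORS** (free). [cite: Lang2002, XV §1] [cite: Shimura1998, §18.2 Lemma (i)] -/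
theorem linearIndependent_typeCells_of_three_pairs (h2 : Module.finrank ℚ k = 2) (i : k →+* K) {n : ℕ} (hdeg : Module.finrank ℚ K = 2 * n) (hn : n = 5) (τ : k →+* ℂ)
    {ι : Type} [Fintype ι] (hι : Fintype.card ι = 3) (Ψ : ι → CMType K) (hcnt : ∀ t, (Finset.univ.filter fun u : K →+* ℂ => u.comp i = τ ∧ u ∈ (Ψ t).1).card = 2)
    (hne : ∀ t t', t ≠ t' → (Ψ t).1 ≠ (Ψ t').1) :
    LinearIndependent ℚ fun t : ι => fun s : {s : K →+* ℂ // s.comp i = τ} =>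
      ((n : ℚ) * (if s.1 ∈ (Ψ t).1 then 1 else 0) - ((Finset.univ.filter fun u : K →+* ℂ => u.comp i = τ ∧ u ∈ (Ψ t).1).card : ℚ)) := by
  subst hn
  refine linearIndependent_typeCells_of_cells h2 i hdeg τ Ψ fun e => ?_
  have hQc : ∀ t, (((Finset.univ : Finset {s : K →+* ℂ // s.comp i = τ}).filter fun s => s.1 ∈ (Ψ t).1).map e.toEmbedding).card = 2 := fun t => by
    rw [Finset.card_map, card_univ_filter_subtype_mem, hcnt]
  refine linearIndependent_cells_of_three_pairs_five_of_card_eq_three rfl hι _ hQc fun t t' htt => ?_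
  by_contra hne'
  refine hne t t' hne' (cmType_val_eq_of_forall_comp h2 i τ _ _ fun s hs => ?_)
  have hm := Finset.ext_iff.1 (Finset.map_injective _ htt) ⟨s, hs⟩
  simpa only [Finset.mem_filter, Finset.mem_univ, true_and] using hm

/-- **FOUR PAIRWISE DISTINCT `(2,3)`-TYPES OVER A DECIC FIELD SATISFYING (H1)–(H2) HAVE INDEPENDENT CENTRED INDICATORS**: (H1) every type shares a `τ`-embedding with
another one, (H2) some `τ`-embedding lies in `1`, `3` or `4` of the types (not the four-cycle, not the triangle with the disjoint edge).
[cite: Lang2002, XV §1] [cite: Shimura1998, §18.2 Lemma (i)] -/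
theorem linearIndependent_typeCells_of_four_pairs (h2 : Module.finrank ℚ k = 2) (i : k →+* K) {n : ℕ} (hdeg : Module.finrank ℚ K = 2 * n) (hn : n = 5) (τ : k →+* ℂ)
    {ι : Type} [Fintype ι] (hι : Fintype.card ι = 4) (Ψ : ι → CMType K) (hcnt : ∀ t, (Finset.univ.filter fun u : K →+* ℂ => u.comp i = τ ∧ u ∈ (Ψ t).1).card = 2)
    (hne : ∀ t t', t ≠ t' → (Ψ t).1 ≠ (Ψ t').1) (hmeet : ∀ t, ∃ t', t' ≠ t ∧ ∃ s : K →+* ℂ, s.comp i = τ ∧ s ∈ (Ψ t).1 ∧ s ∈ (Ψ t').1)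
    (hodd : ∃ s : K →+* ℂ, s.comp i = τ ∧ (Finset.univ.filter fun t => s ∈ (Ψ t).1).card ≠ 0 ∧ (Finset.univ.filter fun t => s ∈ (Ψ t).1).card ≠ 2) :
    LinearIndependent ℚ fun t : ι => fun s : {s : K →+* ℂ // s.comp i = τ} =>
      ((n : ℚ) * (if s.1 ∈ (Ψ t).1 then 1 else 0) - ((Finset.univ.filter fun u : K →+* ℂ => u.comp i = τ ∧ u ∈ (Ψ t).1).card : ℚ)) := by
  subst hn
  refine linearIndependent_typeCells_of_cells h2 i hdeg τ Ψ fun e => ?_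
  have hmem : ∀ (t : ι) (s : K →+* ℂ) (hs : s.comp i = τ),
      e ⟨s, hs⟩ ∈ ((Finset.univ : Finset {s : K →+* ℂ // s.comp i = τ}).filter fun s => s.1 ∈ (Ψ t).1).map e.toEmbedding ↔ s ∈ (Ψ t).1 := fun t s hs => by
    rw [Finset.mem_map_equiv, Equiv.symm_apply_apply]
    simp only [Finset.mem_filter, Finset.mem_univ, true_and]
  have hQc : ∀ t, (((Finset.univ : Finset {s : K →+* ℂ // s.comp i = τ}).filter fun s => s.1 ∈ (Ψ t).1).map e.toEmbedding).card = 2 := fun t => by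
    rw [Finset.card_map, card_univ_filter_subtype_mem, hcnt]
  refine linearIndependent_cells_of_four_pairs_five_of_card_eq_four rfl hι _ hQc (fun t t' htt => ?_) (fun t => ?_) ?_
  · by_contra hne'
    refine hne t t' hne' (cmType_val_eq_of_forall_comp h2 i τ _ _ fun s hs => ?_)
    have hm := Finset.ext_iff.1 (Finset.map_injective _ htt) ⟨s, hs⟩
    simpa only [Finset.mem_filter, Finset.mem_univ, true_and] using hm
  · obtain ⟨t', ht', s, hs, h1, h2'⟩ := hmeet t
    exact ⟨t', ht', e ⟨s, hs⟩, Finset.mem_inter.2 ⟨(hmem t s hs).2 h1, (hmem t' s hs).2 h2'⟩⟩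
  · obtain ⟨s, hs, h0, h2'⟩ := hodd
    have hF : (Finset.univ.filter fun t => e ⟨s, hs⟩ ∈ ((Finset.univ : Finset {s : K →+* ℂ // s.comp i = τ}).filter fun s => s.1 ∈ (Ψ t).1).map e.toEmbedding) =
        Finset.univ.filter fun t => s ∈ (Ψ t).1 := Finset.filter_congr fun t _ => hmem t s hs
    exact ⟨e ⟨s, hs⟩, by rw [hF]; exact h0, by rw [hF]; exact h2'⟩

/-- **THREE TYPES OVER AN OCTIC FIELD WITH `1` OR `2` MEMBERS OVER `τ`, PAIRWISE NEITHER EQUAL NOR CONJUGATE, EVERY `(2,2)`-TYPE SEPARATING EVERY TWO `(1,3)`-TYPES, HAVE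
INDEPENDENT CENTRED INDICATORS** — the octic triples of the menu (the excluded triple `B_q, B_{q'}, B_{qq'}^{±}` is dependent). [cite: Lang2002, XV §1] [cite: Shimura1998, §18.2 Lemma (i)] -/
theorem linearIndependent_typeCells_of_three_octic (h2 : Module.finrank ℚ k = 2) (i : k →+* K) {n : ℕ} (hdeg : Module.finrank ℚ K = 2 * n) (hn : n = 4) (τ : k →+* ℂ)
    {ι : Type} [Fintype ι] (hι : Fintype.card ι = 3) (Ψ : ι → CMType K)
    (hcnt : ∀ t, (Finset.univ.filter fun u : K →+* ℂ => u.comp i = τ ∧ u ∈ (Ψ t).1).card = 1 ∨ (Finset.univ.filter fun u : K →+* ℂ => u.comp i = τ ∧ u ∈ (Ψ t).1).card = 2)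
    (hne : ∀ t t', t ≠ t' → (Ψ t).1 ≠ (Ψ t').1 ∧ (Ψ t').1 ≠ (Ψ t).1ᶜ)
    (hsep : ∀ t₁ t₂ t₃, t₁ ≠ t₂ → (Finset.univ.filter fun u : K →+* ℂ => u.comp i = τ ∧ u ∈ (Ψ t₁).1).card = 1 →
      (Finset.univ.filter fun u : K →+* ℂ => u.comp i = τ ∧ u ∈ (Ψ t₂).1).card = 1 → (Finset.univ.filter fun u : K →+* ℂ => u.comp i = τ ∧ u ∈ (Ψ t₃).1).card = 2 →
      ∀ s₁ s₂ : K →+* ℂ, s₁.comp i = τ → s₂.comp i = τ → s₁ ∈ (Ψ t₁).1 → s₂ ∈ (Ψ t₂).1 → (s₁ ∈ (Ψ t₃).1 ↔ s₂ ∉ (Ψ t₃).1)) :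
    LinearIndependent ℚ fun t : ι => fun s : {s : K →+* ℂ // s.comp i = τ} =>
      ((n : ℚ) * (if s.1 ∈ (Ψ t).1 then 1 else 0) - ((Finset.univ.filter fun u : K →+* ℂ => u.comp i = τ ∧ u ∈ (Ψ t).1).card : ℚ)) := by
  subst hn
  refine linearIndependent_typeCells_of_cells h2 i hdeg τ Ψ fun e => ?_
  have hmem : ∀ (t : ι) (s : K →+* ℂ) (hs : s.comp i = τ),
      e ⟨s, hs⟩ ∈ ((Finset.univ : Finset {s : K →+* ℂ // s.comp i = τ}).filter fun s => s.1 ∈ (Ψ t).1).map e.toEmbedding ↔ s ∈ (Ψ t).1 := fun t s hs => by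
    rw [Finset.mem_map_equiv, Equiv.symm_apply_apply]
    simp only [Finset.mem_filter, Finset.mem_univ, true_and]
  have hQc : ∀ t, (((Finset.univ : Finset {s : K →+* ℂ // s.comp i = τ}).filter fun s => s.1 ∈ (Ψ t).1).map e.toEmbedding).card =
      (Finset.univ.filter fun u : K →+* ℂ => u.comp i = τ ∧ u ∈ (Ψ t).1).card := fun t => by rw [Finset.card_map, card_univ_filter_subtype_mem]
  refine linearIndependent_cells_of_three_four_of_card_eq_three rfl hι _ (fun t => by rw [hQc]; exact hcnt t) (fun t t' htt heq => ?_) (fun t t' htt heq => ?_)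
    (fun t₁ t₂ t₃ h12 hc₁ hc₂ hc₃ heq => ?_)
  · refine (hne t t' htt).1 ((cmType_val_eq_of_forall_comp h2 i τ _ _ fun s hs => ?_).symm)
    rw [← hmem t s hs, ← hmem t' s hs, heq]
  · refine (hne t t' htt).2 (cmType_val_eq_compl_of_forall_comp h2 i τ _ _ fun s hs => ?_)
    rw [← hmem t s hs, ← hmem t' s hs, heq, Finset.mem_compl]
  · rw [hQc] at hc₁ hc₂ hc₃
    -- the `τ`-members of the two `(1,3)`-types
    obtain ⟨s₁, hs₁⟩ := Finset.card_pos.1 (by rw [hc₁]; exact Nat.one_pos)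
    obtain ⟨s₂, hs₂⟩ := Finset.card_pos.1 (by rw [hc₂]; exact Nat.one_pos)
    simp only [Finset.mem_filter, Finset.mem_univ, true_and] at hs₁ hs₂
    have key := hsep t₁ t₂ t₃ h12 hc₁ hc₂ hc₃ s₁ s₂ hs₁.1 hs₂.1 hs₁.2 hs₂.2
    -- the transported singletons are `{e s₁}`, `{e s₂}`
    have hQ₁ : ((Finset.univ : Finset {s : K →+* ℂ // s.comp i = τ}).filter fun s => s.1 ∈ (Ψ t₁).1).map e.toEmbedding = {e ⟨s₁, hs₁.1⟩} :=
      (Finset.eq_of_subset_of_card_le (Finset.singleton_subset_iff.2 ((hmem t₁ s₁ hs₁.1).2 hs₁.2)) (by rw [Finset.card_singleton, hQc, hc₁])).symm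
    have hQ₂ : ((Finset.univ : Finset {s : K →+* ℂ // s.comp i = τ}).filter fun s => s.1 ∈ (Ψ t₂).1).map e.toEmbedding = {e ⟨s₂, hs₂.1⟩} :=
      (Finset.eq_of_subset_of_card_le (Finset.singleton_subset_iff.2 ((hmem t₂ s₂ hs₂.1).2 hs₂.2)) (by rw [Finset.card_singleton, hQc, hc₂])).symm
    rw [hQ₁, hQ₂] at heq
    by_cases h1 : s₁ ∈ (Ψ t₃).1
    · rw [Finset.singleton_inter_of_mem ((hmem t₃ s₁ hs₁.1).2 h1), Finset.singleton_inter_of_notMem (mt (hmem t₃ s₂ hs₂.1).1 (key.1 h1)),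
        Finset.card_singleton, Finset.card_empty] at heq
      exact one_ne_zero heq
    · rw [Finset.singleton_inter_of_notMem (mt (hmem t₃ s₁ hs₁.1).1 h1), Finset.singleton_inter_of_mem ((hmem t₃ s₂ hs₂.1).2 (not_not.1 (mt key.2 h1))),
        Finset.card_singleton, Finset.card_empty] at heq
      exact zero_ne_one heq

end OneField

/-! ## §4 The rank bound read on the types -/

section RankTypes

variable {K : Type} [Field K] [NumberField K] {k : Type} [Field k] [NumberField k]

open Literature.AlgebraicGeometry.Motives (CMType)

/-- **THE RANK BOUND READ ON THE TYPES**: if the centred type indicators of `ι`-many CM types over ONE field, read on its `n ≥ 1` embeddings over `τ`, are linearly independent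
over `ℚ`, then `#ι < n`.  So U7's hypothesis `hli j` (and every units headline) forces `c j ≤ nJ j − 1`: three classes over a sextic field, four over an octic field, five over a
decic field are beyond the units method (G1's rank bound transported by `linearIndependent_cells_map_equiv_iff'`). [cite: Lang2002, XIII §4] -/
theorem fintype_card_lt_of_linearIndependent_typeCells (h2 : Module.finrank ℚ k = 2) (i : k →+* K) {n : ℕ} (hdeg : Module.finrank ℚ K = 2 * n) (hn : 0 < n) (τ : k →+* ℂ)
    {ι : Type} [Fintype ι] (Ψ : ι → CMType K)
    (hli : LinearIndependent ℚ fun t : ι => fun s : {s : K →+* ℂ // s.comp i = τ} =>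
      ((n : ℚ) * (if s.1 ∈ (Ψ t).1 then 1 else 0) - ((Finset.univ.filter fun u : K →+* ℂ => u.comp i = τ ∧ u ∈ (Ψ t).1).card : ℚ))) :
    Fintype.card ι < n := by
  let e : {s : K →+* ℂ // s.comp i = τ} ≃ Fin n := Fintype.equivFinOfCardEq (card_subtype_comp_eq i hdeg h2 τ)
  have hfun : (fun t : ι => fun s : {s : K →+* ℂ // s.comp i = τ} =>
      ((n : ℚ) * (if s.1 ∈ (Ψ t).1 then 1 else 0) - ((Finset.univ.filter fun u : K →+* ℂ => u.comp i = τ ∧ u ∈ (Ψ t).1).card : ℚ))) =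
      fun t : ι => fun s : {s : K →+* ℂ // s.comp i = τ} => ((n : ℚ) * (if s ∈ (Finset.univ : Finset {s : K →+* ℂ // s.comp i = τ}).filter fun s => s.1 ∈ (Ψ t).1
        then 1 else 0) - ((((Finset.univ : Finset {s : K →+* ℂ // s.comp i = τ}).filter fun s => s.1 ∈ (Ψ t).1).map e.toEmbedding).card : ℚ)) := by
    funext t s
    rw [Finset.card_map, card_univ_filter_subtype_mem]
    simp only [Finset.mem_filter, Finset.mem_univ, true_and]
  rw [hfun, ← linearIndependent_cells_map_equiv_iff' e] at hli
  exact fintype_card_lt_of_linearIndependent_cells hn _ hli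

end RankTypes

end Summit.HodgeConjecture.CorCM.MultiFieldWeil

end
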